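import Summits.NavierStokesRegularity.FluidComputer.TubeTableFat18
import HarnessLib

/-!
# Kernel run of the fat restart tube, chunks 6 … 11 (bp3 gen 15)

HONEST FRAMING: low prior, high value-of-information experiment on Tao's machine paradigm; NOT a
claim that NS blows up.

Kernel evaluations (`decide +kernel`; no `native_decide`, no extra axioms) of the in-tree tube checker
`runTube` (`P = 60`, 12 Taylor terms, cube `Rt`, read-out `CLt`) on the chunks `cF 6 … cF 11` of
`TubeTableFat18.lean`, each from the recorded boundary state `sF i` to `sF (i+1)`.

[cite: Tao2016AveragedNS, §5.5 Thm 5.3 (5.5)]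
-/

namespace Summit.NavierStokesRegularity.FluidComputer

namespace TubeTableFat18

open Literature.Analysis.FluidPDE.FluidComputer Literature.Analysis.FluidPDE.FluidComputer.TubeTable
open Literature.Analysis.FluidPDE.FluidComputer.ThresholdLevelTable (GIt)

set_option maxHeartbeats 10000000 in
set_option maxRecDepth 200000 in
/-- Chunk 6 of the fat tube run (steps 300 … 349, `h = 2^-11`). [folklore] -/
theorem runF_6 : runTube 60 12 GIt CLt Rt (sF 6) (cF 6) = some (sF (6 + 1)) := by
  decide +kernel

set_option maxHeartbeats 10000000 in
set_option maxRecDepth 200000 in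
/-- Chunk 7 of the fat tube run (steps 350 … 399, `h = 2^-11`). [folklore] -/
theorem runF_7 : runTube 60 12 GIt CLt Rt (sF 7) (cF 7) = some (sF (7 + 1)) := by
  decide +kernel

set_option maxHeartbeats 10000000 in
set_option maxRecDepth 200000 in
/-- Chunk 8 of the fat tube run (steps 400 … 449, `h = 2^-11`). [folklore] -/
theorem runF_8 : runTube 60 12 GIt CLt Rt (sF 8) (cF 8) = some (sF (8 + 1)) := by
  decide +kernel

set_option maxHeartbeats 10000000 in
set_option maxRecDepth 200000 in
/-- Chunk 9 of the fat tube run (steps 450 … 499, `h = 2^-11`). [folklore] -/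
theorem runF_9 : runTube 60 12 GIt CLt Rt (sF 9) (cF 9) = some (sF (9 + 1)) := by
  decide +kernel

set_option maxHeartbeats 10000000 in
set_option maxRecDepth 200000 in
/-- Chunk 10 of the fat tube run (steps 500 … 549, `h = 2^-11`). [folklore] -/
theorem runF_10 : runTube 60 12 GIt CLt Rt (sF 10) (cF 10) = some (sF (10 + 1)) := by
  decide +kernel

set_option maxHeartbeats 10000000 in
set_option maxRecDepth 200000 in
/-- Chunk 11 of the fat tube run (steps 550 … 599, `h = 2^-11`). [folklore] -/
theorem runF_11 : runTube 60 12 GIt CLt Rt (sF 11) (cF 11) = some (sF (11 + 1)) := by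
  decide +kernel

end TubeTableFat18

end Summit.NavierStokesRegularity.FluidComputer
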